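import Summits.BirchSwinnertonDyer.BirchSwinnertonDyer.Theorems.KatoDescentPotSupersingularFineSelmerDescentOfDivisibility
import Literature.NumberTheory.EllipticCurves.IwasawaAlgebraPseudoNullProofs
import Literature.NumberTheory.EllipticCurves.IwasawaAlgebraCharIdealProofs
import HarnessLib

/-!
# The KATO-H2 socket: Kato's Thm. 14.5 (3) `#H²(ℤ[1/p],T_pW) ∣ [H¹(ℤ[1/p],T_pW) : z]` on the fine road, EXACT, through ANY
# `Λ`-module `𝐇²` receiving `X₀(W/ℚ_∞)` with finite cokernel and carrying Kato's (14.14.1) count `#𝐇²[T] = #(descent cokernel)`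
# (route `KatoDescentPotSupersingular` / `…Tame…`, crux M = stmt-BirchSwinnertonDyer-19196; route-free helper)

Seat `bsd-potss-rkm` g18 (prover; cell `bsd-potss`), item stmt-BirchSwinnertonDyer-19196 (`--supports … --as helper`; closes
nothing).  HONEST FRAMING: BSD is not proved by any of this; nothing is booked; theorems only (no definition, no named fact).

WHY (memo `HOME/rkm/FINDING-19196-rkm-g18.md`, brick (c)).  The g15/g16 fine road descends the one-sided Λ-adic divisibility
`char_Λ X₀(W/ℚ_∞) ∣ char_Λ(𝐇¹_Γ/Λs)` to `#Sel₀(W/ℚ_∞)^Γ · #desc ∣ #Sel₀(W/ℚ_∞)_Γ · [A : s₀]`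
(`FineSelmerDescentOfDivisibility`), which is SHORT of Kato's Thm. 14.5 (3) `#H²(ℤ[1/p],T) ≤ [A : z]` by the parasitic factor
`#X₀[T] = #Sel₀(W/ℚ_∞)_Γ` and by `p^{t_p − t₀}` — both repaired in Kato §14.14 by his compact Iwasawa cohomology `𝐇²(T)`:
(14.14.1) `0 → 𝐇¹_Γ/T → A → 𝐇²[T] → 0` (so `#𝐇²[T] = #desc`), `X₀ ↪ 𝐇²` with finite (pseudo-null) cokernel at a potentially good `p`
(Λ-adic Poitou–Tate; Kurihara 2002 / Kobayashi 2003 §7), and (14.14.2)+(14.9.3) `#𝐇²/T = #H²(ℤ[1/p],T) = #Sel_str^{ur}(ℚ,W)·p^{t_p−t₀}`.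
The tree has no `𝐇²`.  This file proves the ALGEBRA of §14.14 for an ARBITRARY `Λ`-module `H2` in that position, so that the
construction item «KATO-H2» (the memo's brick (c)) plugs in by supplying `H2 := 𝐇²(T_pW)` with its three printed properties:

* §1 `charIdeal_eq_of_injective_of_finite_quotient` — an injective `Λ`-linear map with finite cokernel is a pseudo-isomorphism, so
  `char_Λ X = char_Λ H2` (tree `charIdeal_eq_of_arePseudoIsomorphic`, `isPseudoNull_of_finite`); `isTorsion_of_injective_of_finite_quotient`;
  `natCard_coinvariants_mul_dvd_of_embedding` — the Γ-Euler-characteristic divisibility of `IwasawaEulerCharDivisibilityProofs`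
  (`#(M/TM)·#N[T] ∣ #M[T]·#(N/TN)` for `char N ⊆ char M`) TRANSPORTED from `M = X` to `M = H2`.
* §2 **`natCard_coinvariants_dvd_index_of_katoH2`** — on a rank-0 row (`W(ℚ)`, `Ш(W)[p^∞]` finite), cyclotomic pin, fine dual datum
  `Y` with `Sel₀(W/ℚ_∞)[p]` finite, a class `s ∈ 𝐇¹_Γ` with `proj₀ s` non-torsion and `char(𝐇¹_Γ/Λs) ⊆ char X₀`: for EVERY f.g.
  `Λ`-module `H2` with `X₀ ↪ H2` of finite cokernel and **`#H2[T] = #desc`** ((14.14.1) as a count):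
  **`#(H2/T·H2) ∣ [H¹(ℤ[1/p],T_pW) : ℤ_p s₀]`** — Kato's 14.5 (3) with `#H²(ℤ[1/p],T)` read as `#𝐇²_Γ` ((14.14.2)), parasitic term GONE.
* §3 `selStrUr_mul_dvd_of_katoH2_count` — with the (14.14.2)+(14.9.3) count `#(H2/T·H2)·#E(ℚ)[p^∞] = #Sel_str^{ur}(ℚ,W)·#E(ℚ_p)[p^∞]` supplied
  as a numerical hypothesis: `#Sel_str^{ur}(ℚ,W)·#E(ℚ_p)[p^∞] ∣ #E(ℚ)[p^∞]·[A : s₀]` — the Iwasawa-side input (vi) of crux M's ledger, EXACT.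

What the hypotheses DO NOT pin (honesty): `H2` is abstract; the file asserts nothing about Kato's `𝐇²`; it isolates exactly which three
properties of `𝐇²` the exact node consumes ((12.2.1)/12.4 (1) finiteness+torsion are DERIVED here from `X₀ ↪ H2` finite cokernel).

References: K. Kato, Astérisque 295 (2004) (12.2.1), Thm. 12.4 (1), §13.8, Thm. 14.5 (3) (p. 236), (14.9.3) (p. 240), §14.14 (14.14.1)–(14.14.2)
and Lemma 14.15 (pp. 243–244) [Kato2004Asterisque]; R. Greenberg, LNM 1716 §4 Lemma 4.2 [GreenbergLNM1716]; L. Washington, GTM 83 §13.2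
[Washington1997]; M. Kurihara, Invent. math. 149 (2002); S. Kobayashi, Invent. math. 152 (2003) §7.
-/

-- the summit and its single problem are both named `BirchSwinnertonDyer` (registry layout D-0017)
set_option linter.dupNamespace false
set_option autoImplicit false

noncomputable section

open scoped NumberField
open Field IsDedekindDomain WeierstrassCurve
open Literature.NumberTheory.GaloisRepresentations Literature.NumberTheory.EllipticCurves
open Literature.NumberTheory.EllipticCurves.GreenbergSelmer
open Literature.NumberTheory.EllipticCurves.Kato2004 Literature.NumberTheory.EllipticCurves.Kato2004.EulerSystemValues
open Literature.NumberTheory.EllipticCurves.IwasawaAlgebra Literature.NumberTheory.EllipticCurves.IwasawaDual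

namespace Summit.BirchSwinnertonDyer.BirchSwinnertonDyer.Theorems.KatoH2Descent

/-! ## §1 Algebra: an embedding with finite cokernel transports the characteristic ideal and the Euler-characteristic divisibility -/

section Algebra

variable {p : ℕ} [Fact p.Prime]
variable {X H2 N : Type} [AddCommGroup X] [Module (IwasawaAlgebra p) X] [AddCommGroup H2] [Module (IwasawaAlgebra p) H2]
  [AddCommGroup N] [Module (IwasawaAlgebra p) N]

/-- **An injective `Λ`-linear map with finite cokernel is a pseudo-isomorphism** (kernel `0`, cokernel finite hence pseudo-null over
`Λ = ℤ_p⟦T⟧`, tree `isPseudoNull_of_finite`). [cite: Washington1997, §13.2] -/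
theorem isPseudoIsomorphism_of_injective_of_finite_quotient (e : X →ₗ[IwasawaAlgebra p] H2)
    (he : Function.Injective e) [Finite (H2 ⧸ LinearMap.range e)] : e.IsPseudoIsomorphism := by
  have hker : Subsingleton (LinearMap.ker e) := by
    rw [LinearMap.ker_eq_bot.2 he]
    infer_instance
  exact ⟨Module.isPseudoNull_of_subsingleton _ _, isPseudoNull_of_finite p _⟩

/-- **`char_Λ X = char_Λ H2`** for an injective `Λ`-linear `X → H2` with finite cokernel (pseudo-isomorphic modules have the same
characteristic ideal, tree `charIdeal_eq_of_arePseudoIsomorphic`). [cite: Washington1997, §13.2] -/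
theorem charIdeal_eq_of_injective_of_finite_quotient (e : X →ₗ[IwasawaAlgebra p] H2)
    (he : Function.Injective e) [Finite (H2 ⧸ LinearMap.range e)] :
    Module.charIdeal (IwasawaAlgebra p) X = Module.charIdeal (IwasawaAlgebra p) H2 :=
  Module.charIdeal_eq_of_arePseudoIsomorphic ⟨e, isPseudoIsomorphism_of_injective_of_finite_quotient e he⟩

/-- **`H2` is `Λ`-torsion** when it receives a torsion module with finite cokernel: `#(H2/X)·h ∈ X` is killed by a non-zero-divisor.
[cite: Washington1997, §13.2] -/
theorem isTorsion_of_injective_of_finite_quotient (hX : Module.IsTorsion (IwasawaAlgebra p) X)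
    (e : X →ₗ[IwasawaAlgebra p] H2) [Finite (H2 ⧸ LinearMap.range e)] :
    Module.IsTorsion (IwasawaAlgebra p) H2 := by
  intro h
  -- `n • h ∈ range e` for `n = #(H2/range e)`
  set n : ℕ := Nat.card (H2 ⧸ LinearMap.range e) with hn
  have hn0 : n ≠ 0 := Nat.card_pos.ne'
  have hnΛ : (n : IwasawaAlgebra p) ≠ 0 := by
    intro h0
    have h1 := congrArg (PowerSeries.constantCoeff (R := ℤ_[p])) h0
    rw [map_natCast, map_zero] at h1
    exact hn0 (by exact_mod_cast h1)
  have hmem : (n : IwasawaAlgebra p) • h ∈ LinearMap.range e := by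
    rw [← Submodule.Quotient.mk_eq_zero, Submodule.Quotient.mk_smul, Nat.cast_smul_eq_nsmul]
    exact card_nsmul_eq_zero'
  obtain ⟨x, hx⟩ := hmem
  obtain ⟨⟨a, ha⟩, hax⟩ := @hX x
  refine ⟨⟨a * (n : IwasawaAlgebra p), mul_mem ha (mem_nonZeroDivisors_of_ne_zero hnΛ)⟩, ?_⟩
  change (a * (n : IwasawaAlgebra p)) • h = 0
  rw [mul_smul, ← hx, ← map_smul, show a • x = 0 from hax, map_zero]

variable [Module.Finite (IwasawaAlgebra p) H2] [Module.Finite (IwasawaAlgebra p) N]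

/-- **The Γ-Euler-characteristic divisibility transported to `H2`**: if `char_Λ N ⊆ char_Λ X`, `N/TN` is finite, `X` and `N` are torsion,
and `X ↪ H2` has finite cokernel, then `#(H2/T·H2) · #N[T] ∣ #H2[T] · #(N/TN)` (tree `natCard_coinvariants_mul_dvd_of_charIdeal_le` with
`char_Λ H2 = char_Λ X`).  Greenberg's Lemma 4.2 / Kato's Lemma 14.15 in the shape §14.14 uses it.
[cite: Kato2004Asterisque, Lemma 14.15 (p. 244) and §14.14 (p. 243)] [cite: GreenbergLNM1716, §4 Lemma 4.2 (p. 102)] -/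
theorem natCard_coinvariants_mul_dvd_of_embedding (hX : Module.IsTorsion (IwasawaAlgebra p) X)
    (hN : Module.IsTorsion (IwasawaAlgebra p) N)
    (hchar : Module.charIdeal (IwasawaAlgebra p) N ≤ Module.charIdeal (IwasawaAlgebra p) X)
    (hfin : Finite (coinvariants p N)) (e : X →ₗ[IwasawaAlgebra p] H2) (he : Function.Injective e)
    [Finite (H2 ⧸ LinearMap.range e)] :
    (Finite (invariants p H2) ∧ Finite (coinvariants p H2) ∧ Finite (invariants p N)) ∧
      Nat.card (coinvariants p H2) * Nat.card (invariants p N) ∣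
        Nat.card (invariants p H2) * Nat.card (coinvariants p N) := by
  have hH2 : Module.IsTorsion (IwasawaAlgebra p) H2 := isTorsion_of_injective_of_finite_quotient hX e
  have hchar' : Module.charIdeal (IwasawaAlgebra p) N ≤ Module.charIdeal (IwasawaAlgebra p) H2 := by
    rw [← charIdeal_eq_of_injective_of_finite_quotient e he]; exact hchar
  exact ⟨finite_coinvariants_of_charIdeal_le hH2 hN hchar' hfin, natCard_coinvariants_mul_dvd_of_charIdeal_le hH2 hN hchar' hfin⟩

end Algebra

/-! ## §2 The socket: Kato's 14.5 (3) exact, through any `H2` with `X₀ ↪ H2` finite cokernel and `#H2[T] = #desc` -/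

section Socket

variable (W : WeierstrassCurve ℚ) [W.IsElliptic] (p : ℕ) [Fact p.Prime]
  [ContinuousSMul ℤ_[p] (W.tateModule p)]
  [Finite W.toAffine.Point] [Finite (AddCommGroup.primaryComponent W.sha p)]
  {κ : ZpExtension ℚ p} {γ : absoluteGaloisGroup ℚ}

/-- **The KATO-H2 socket (Kato §14.14, Thm. 14.5 (3), EXACT, H²-abstract).**  Rank-0 row (`W(ℚ)`, `Ш(W)[p^∞]` finite), cyclotomic
`(κ,γ)`, pinned `I = 𝐇¹_Γ(T_pW)`, fine dual datum `Y` (`X₀ = Y.X`) with `Sel₀(W/ℚ_∞)[p]` finite, a class `s ∈ 𝐇¹_Γ` with `proj₀ s` of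
infinite order and the one-sided divisibility `char_Λ(𝐇¹_Γ/Λs) ⊆ char_Λ X₀` (any source: g15's reducible road mod {13.4, Serre, FW, Lim 3.5},
the irreducible roads of `FineSelmerDescentOfDivisibility` §2 / `…BigImage`).  Then for EVERY finitely generated `Λ`-module `H2` with an
injective `Λ`-linear `e : X₀ → H2` of finite cokernel (Kato: `X₀ ↪ 𝐇²(T)`, cokernel `⊆ E(ℚ_{∞,𝔭})[p^∞]^∨` at a potentially good `p`) and
`#H2[T] = #(H¹(ℤ[1/p],T_pW)/proj₀(𝐇¹_Γ/T))` (Kato (14.14.1)):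
**`#(H2/T·H2) ∣ [H¹(ℤ[1/p],T_pW) : ℤ_p s₀]`** — i.e. `#H²(ℤ[1/p],T) ≤ [A : z]` once `#(𝐇²/T) = #H²(ℤ[1/p],T)` ((14.14.2)) is supplied.
[cite: Kato2004Asterisque, Thm. 14.5 (3) (p. 236), §14.14 (14.14.1)–(14.14.2) and Lemma 14.15 (pp. 243–244)]
[cite: GreenbergLNM1716, §4 Lemma 4.2 (p. 102)] -/
theorem natCard_coinvariants_dvd_index_of_katoH2 (hκ : κ.IsCyclotomic) (hγ : κ.IsTopGenerator γ)
    (I : IwasawaH1Data W p κ γ) (Y : W.FineSelmerDualData κ γ)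
    (hfinp : Set.Finite {t : W.fineSelmerInfty κ | p • t = 0}) (s : I.H) (hnt : ¬ IsOfFinAddOrder (I.proj 0 s))
    (hchar : Module.charIdeal (IwasawaAlgebra p) (I.H ⧸ Submodule.span (IwasawaAlgebra p) {s}) ≤
      Module.charIdeal (IwasawaAlgebra p) Y.X)
    {H2 : Type} [AddCommGroup H2] [Module (IwasawaAlgebra p) H2] [Module.Finite (IwasawaAlgebra p) H2]
    (e : Y.X →ₗ[IwasawaAlgebra p] H2) (he : Function.Injective e) [Finite (H2 ⧸ LinearMap.range e)]
    (hT : Nat.card (invariants p H2) = Nat.card I.descentCokernel) :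
    Finite (coinvariants p H2) ∧
      Nat.card (coinvariants p H2) ∣
        Nat.card (integralH1 (tateRep W p) p (κ.layerSubgroup 0) ⧸
          Submodule.span ℤ_[p] {(⟨I.proj 0 s, I.proj_mem 0 s⟩ : integralH1 (tateRep W p) p (κ.layerSubgroup 0))}) := by
  have hs0 : s ≠ 0 := by
    rintro rfl
    exact hnt (by rw [map_zero]; exact isOfFinAddOrder_iff_nsmul_eq_zero.mpr ⟨1, one_pos, by simp⟩)
  haveI : Module.Finite (IwasawaAlgebra p) I.H := IwasawaH1Data.module_finite_of_isCyclotomic hκ hγ I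
  haveI := I.noZeroSMulDivisors hγ
  have htors : Module.IsTorsion (IwasawaAlgebra p) (I.H ⧸ Submodule.span (IwasawaAlgebra p) {s}) :=
    ReducibleZetaDivisibility.isTorsion_quotient_span_singleton_of_ne_zero W p hκ hγ I hs0
  haveI : Module.Finite (IwasawaAlgebra p) Y.X := Y.module_finite_of_finite_pTorsion hγ hfinp
  haveI : Finite (Y.X ⧸ (IwasawaAlgebra.augIdealP p • (⊤ : Submodule (IwasawaAlgebra p) Y.X))) :=
    Y.finite_quotient_augIdealP_of_finite_pTorsion hfinp
  have hYtors : Module.IsTorsion (IwasawaAlgebra p) Y.X :=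
    IwasawaModuleFinitePadicInt.isTorsion_of_finite_quotient_augIdealP p Y.X inferInstance
  -- finiteness of `N/TN`, `N = 𝐇¹_Γ/Λs` (the pin, (R0))
  obtain ⟨-, hfinN⟩ := ReducibleFineSelmerDescentCount.finite_coinvariants_quotient_span_of_not_isOfFinAddOrder hκ hγ I s hnt
  -- the Γ-Euler-characteristic descent through `H2`
  obtain ⟨⟨hiM, hcM, hiN⟩, hdvd⟩ := natCard_coinvariants_mul_dvd_of_embedding hYtors htors hchar hfinN e he
  rw [Kato2004.natCard_invariants_quotient_span_eq_one s hs0 hiN, mul_one,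
    Kato2004.natCard_coinvariants_quotient_span s, hT] at hdvd
  refine ⟨hcM, ?_⟩
  rw [ReducibleFineSelmerDescentCount.natCard_quotient_span_eq_natCard_descentCokernel_mul hκ hγ I s]
  exact hdvd

/-! ## §3 With the (14.14.2)+(14.9.3) count supplied: the Iwasawa-side input (vi) of crux M, exact -/

/-- **(vi) of crux M's level-0 ledger, exact, from the KATO-H2 counts.**  Under the hypotheses of
`natCard_coinvariants_dvd_index_of_katoH2`, if moreover the count (14.14.2)+(14.9.3)
`#(H2/T·H2) · #E(ℚ)[p^∞] = #Sel_str^{ur}(ℚ, E[p^∞]) · #E(ℚ_p)[p^∞]` holds (supplied as a numerical hypothesis `hcount` on three naturals —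
Kato: `𝐇²/T = H²(ℤ[1/p],T)`, whose order is `#Ker(H² → H²(ℚ_p,T)) · #H²(ℚ_p,T)/#H⁰(ℚ,W) = #Sel_str^{ur}·p^{t_p−t₀}`), then
**`#Sel_str^{ur}(ℚ,E[p^∞]) · #E(ℚ_p)[p^∞] ∣ #E(ℚ)[p^∞] · [H¹(ℤ[1/p],T_pW) : ℤ_p s₀]`**.  Pure bookkeeping over §2; records the exact shape
in which brick (c) feeds the node. [cite: Kato2004Asterisque, (14.9.3) (p. 240), (14.14.2) (p. 243), Prop. 14.16 (pp. 244–245)] -/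
theorem selStrUr_mul_dvd_of_katoH2_count (hκ : κ.IsCyclotomic) (hγ : κ.IsTopGenerator γ)
    (I : IwasawaH1Data W p κ γ) (Y : W.FineSelmerDualData κ γ)
    (hfinp : Set.Finite {t : W.fineSelmerInfty κ | p • t = 0}) (s : I.H) (hnt : ¬ IsOfFinAddOrder (I.proj 0 s))
    (hchar : Module.charIdeal (IwasawaAlgebra p) (I.H ⧸ Submodule.span (IwasawaAlgebra p) {s}) ≤
      Module.charIdeal (IwasawaAlgebra p) Y.X)
    {H2 : Type} [AddCommGroup H2] [Module (IwasawaAlgebra p) H2] [Module.Finite (IwasawaAlgebra p) H2]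
    (e : Y.X →ₗ[IwasawaAlgebra p] H2) (he : Function.Injective e) [Finite (H2 ⧸ LinearMap.range e)]
    (hT : Nat.card (invariants p H2) = Nat.card I.descentCokernel)
    (selStrUr torsP torsGlobal : ℕ) (hcount : Nat.card (coinvariants p H2) * torsGlobal = selStrUr * torsP) :
    selStrUr * torsP ∣ torsGlobal *
      Nat.card (integralH1 (tateRep W p) p (κ.layerSubgroup 0) ⧸
        Submodule.span ℤ_[p] {(⟨I.proj 0 s, I.proj_mem 0 s⟩ : integralH1 (tateRep W p) p (κ.layerSubgroup 0))}) := by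
  obtain ⟨-, hdvd⟩ := natCard_coinvariants_dvd_index_of_katoH2 W p hκ hγ I Y hfinp s hnt hchar e he hT
  rw [← hcount, mul_comm (Nat.card (coinvariants p H2)) torsGlobal]
  exact mul_dvd_mul_left _ hdvd

end Socket

/-! ## §4 (appended) (12.2.1) for `H2` is DERIVED too: finite generation passes along `X₀ ↪ H2` with finite cokernel -/

section FiniteGeneration

variable {p : ℕ} [Fact p.Prime]
variable {X H2 : Type} [AddCommGroup X] [Module (IwasawaAlgebra p) X] [AddCommGroup H2] [Module (IwasawaAlgebra p) H2]

/-- **`H2` is finitely generated over `Λ`** when it receives a finitely generated module with finite cokernel (`range e` f.g., `H2/range e` finite;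
Mathlib `Module.Finite.of_submodule_quotient`; a finite module is finitely generated).  So of Kato's (12.2.1)/Thm. 12.4 (1) for `𝐇²`
NOTHING is assumed by the socket: both follow from `X₀ ↪ 𝐇²` with finite cokernel (correcting the wording of the module docstring,
where finite generation was still listed as a hypothesis of §2). [cite: Kato2004Asterisque, (12.2.1) (p. 220)] -/
theorem moduleFinite_of_finite_quotient [Module.Finite (IwasawaAlgebra p) X]
    (e : X →ₗ[IwasawaAlgebra p] H2) [Finite (H2 ⧸ LinearMap.range e)] :
    Module.Finite (IwasawaAlgebra p) H2 := by
  haveI : Module.Finite (IwasawaAlgebra p) (LinearMap.range e) :=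
    Module.Finite.of_surjective (e.rangeRestrict) e.surjective_rangeRestrict
  haveI : Module.Finite (IwasawaAlgebra p) (H2 ⧸ LinearMap.range e) := Module.Finite.of_finite
  exact Module.Finite.of_submodule_quotient (LinearMap.range e)

end FiniteGeneration

section SocketNoFG

variable (W : WeierstrassCurve ℚ) [W.IsElliptic] (p : ℕ) [Fact p.Prime]
  [ContinuousSMul ℤ_[p] (W.tateModule p)]
  [Finite W.toAffine.Point] [Finite (AddCommGroup.primaryComponent W.sha p)]
  {κ : ZpExtension ℚ p} {γ : absoluteGaloisGroup ℚ}

/-- **The KATO-H2 socket with NO hypothesis on `H2` beyond the embedding** (`natCard_coinvariants_dvd_index_of_katoH2` with the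
finite generation of `H2` derived by `moduleFinite_of_finite_quotient`): for every `Λ`-module `H2` with an injective
`Λ`-linear `X₀ → H2` of finite cokernel and `#H2[T] = #desc`, `#(H2/T·H2) ∣ [H¹(ℤ[1/p],T_pW) : ℤ_p s₀]`.
[cite: Kato2004Asterisque, Thm. 14.5 (3) (p. 236), §14.14 (14.14.1)–(14.14.2) and Lemma 14.15 (pp. 243–244)] -/
theorem natCard_coinvariants_dvd_index_of_embedding_of_count (hκ : κ.IsCyclotomic) (hγ : κ.IsTopGenerator γ)
    (I : IwasawaH1Data W p κ γ) (Y : W.FineSelmerDualData κ γ)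
    (hfinp : Set.Finite {t : W.fineSelmerInfty κ | p • t = 0}) (s : I.H) (hnt : ¬ IsOfFinAddOrder (I.proj 0 s))
    (hchar : Module.charIdeal (IwasawaAlgebra p) (I.H ⧸ Submodule.span (IwasawaAlgebra p) {s}) ≤
      Module.charIdeal (IwasawaAlgebra p) Y.X)
    {H2 : Type} [AddCommGroup H2] [Module (IwasawaAlgebra p) H2]
    (e : Y.X →ₗ[IwasawaAlgebra p] H2) (he : Function.Injective e) [Finite (H2 ⧸ LinearMap.range e)]
    (hT : Nat.card (invariants p H2) = Nat.card I.descentCokernel) :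
    Finite (coinvariants p H2) ∧
      Nat.card (coinvariants p H2) ∣
        Nat.card (integralH1 (tateRep W p) p (κ.layerSubgroup 0) ⧸
          Submodule.span ℤ_[p] {(⟨I.proj 0 s, I.proj_mem 0 s⟩ : integralH1 (tateRep W p) p (κ.layerSubgroup 0))}) := by
  haveI : Module.Finite (IwasawaAlgebra p) Y.X := Y.module_finite_of_finite_pTorsion hγ hfinp
  haveI : Module.Finite (IwasawaAlgebra p) H2 := moduleFinite_of_finite_quotient e
  exact natCard_coinvariants_dvd_index_of_katoH2 W p hκ hγ I Y hfinp s hnt hchar e he hT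

end SocketNoFG

end Summit.BirchSwinnertonDyer.BirchSwinnertonDyer.Theorems.KatoH2Descent

end
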